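import Literature.NumberTheory.Sieve.IwaniecAlmostPrimes
import HarnessLib

/-!
# Iwaniec (1978) for a general quadratic `G = aX² + bX + c`: the Theorem from the weighted sum

H. Iwaniec, *Almost-primes represented by quadratic polynomials*, Invent. Math. **47** (1978)
171–188, Theorem p. 172 [cite: IwaniecInventiones1978, Theorem p. 172] — the named fact
`Literature.NumberTheory.Sieve.Iwaniec1978.theorem_quadratic` of `IwaniecAlmostPrimes.lean`: for
`G = an² + bn + c ∈ ℤ[X]` irreducible with `a > 0`, `c` odd, `G(n) = P₂` infinitely often and
`#{n ≤ x : G(n) = P₂} > (1/77) Γ_G x/log x` for all large `x`.  Iwaniec prints the proof for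
`G = n² + 1` only ("the general case being similar"); the general case is carried out in
R. J. Lemke Oliver, *Almost-primes represented by quadratic polynomials*, Acta Arith. **151**
(2012) 241–261 [cite: LemkeOliverActaArith2012, Theorem 1 and §2], read in full for this file.

**What Lemke Oliver proves, compared with `theorem_quadratic`.**  His Theorem 1 (p. 242) assumes
`G ∈ ℤ[x]` irreducible, `c₂ > 0` and `Γ_G ≠ 0` (weaker than "`c` odd", which forces `ρ(2) ≤ 1`)
and concludes that `G(n)` is a SQUAREFREE number with at most two prime factors for infinitely
many `n`; the constant is suppressed throughout ("`W(𝒜, z) ≫ x/log x`", p. 244), the level of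
distribution is `x^{1+γ₀}` with `γ₀ = (1 − α₀)/(2(1 + β₀))` in terms of unspecified exponents
`α₀ < 1`, `β₀` of his equidistribution Lemma 4 = Lemma 8 (for non-monic `G`, or `disc G > 0`,
the printed exponents are weaker than Iwaniec's `M^{3/4}`), and the sieve functions are evaluated
in the limit `α → 1⁺`, `γ = α/6` (p. 251).  So the constant `1/77` of Iwaniec's display (1) is, for
a general quadratic, printed by Iwaniec without proof and not re-derived by Lemke Oliver; the
exposition arXiv:1910.02885 (Kapoor, 2006), which restates (1) with `1/77` for general `G`,
parametrises the roots of `(2aΩ + b)² ≡ disc (mod D)` by `D = r² + s²` (its Lemma 9, valid for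
`disc = −4` only).  `theorem_quadratic` is nevertheless a faithful rendering of Iwaniec's printed
Theorem, and this file does not alter it.

**What is PROVED here** (everything; no named fact is introduced): the elementary top layer of the
printed proof for a general `G`, i.e. §2.1 of Lemke Oliver / §2 p. 173 of Iwaniec, and the
reduction of `theorem_quadratic` to the weighted-sieve lower bound (2):

* `isBatemanHornSystem_quadPoly`: Iwaniec's hypotheses (`a > 0`, `c` odd, `G` irreducible in
  `ℤ[X]`, hence primitive) make `{G}` a Bateman–Horn system — no fixed prime divisor, since
  `G(0) = c` is odd and `p ∣ G(0), G(1), G(−1)` for an odd prime `p` would give `p ∣ a, b, c`; so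
  `Γ_G = batemanHornConst ![G] / 2 > 0` (`gammaG_pos`) by the tree's PROVED Bateman–Horn
  convergence theorem (`IsBatemanHornSystem.hasBatemanHornConst_holds`).
* `card_filter_sq_dvd_quad_le`: for a prime `p ∤ a`, `p ∤ b² − 4ac`, the `n ≤ N` with
  `p² ∣ G(n)` lie in at most two residue classes modulo `p²` (`sq_dvd_conj`: incongruent solutions
  are conjugate, `p² ∣ a(m + n) + b`), so there are at most `2(N/p² + 1)` of them;
  `disc_ne_zero`: `b² − 4ac ≠ 0` (Gauss's lemma).
* `weightedSumG`: Richert's weighted sum `W(𝒜, z)` for `𝒜 = {G(n) : 1 ≤ n ≤ x}` (Lemke Oliver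
  (2.3)) with Iwaniec's weights (`richertWeight`, `IwaniecAlmostPrimes.lean`) at `λ = 2` relative
  to the size parameter `X = Kx`, `K = a + |b| + |c|` (`|G(n)| ≤ Kx² ≤ X²` on `[1, x]`, which is
  what Lemma 1 needs; Lemke Oliver's thresholds `x^{λ/4}, x^{λ/2}` with `x^{λ/2} = X`).
* `card_exceptional_le`, `weightedSumG_le_card`: `W(𝒜, z) ≤ #{n ≤ x : Ω(|G(n)|) ≤ 2} +
  (4 + 2K) x/√z` for `z > max(a, |b² − 4ac|)`, `z ≥ 2` — Lemma 1 (PROVED in the first file) plus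
  the non-squarefree count; new for general `G`: a member `|G(n)| = p²` IS a `P₂` (squares occur
  in `𝒜` for general `G`), and only `p ∤ a · disc` have `ρ(p²) ≤ 2`, whence the threshold on `z`.
* `theorem_quadratic_of_weightedSumG_lower`: **`theorem_quadratic` follows from (2) for general
  `G`** in the form "for every such `G` there is `C > 1/77` with `W(𝒜_G, x^{1/5}) ≥ C Γ_G x/log x`
  for all large `x`" (Iwaniec p. 187 gives `W(𝒜, z) > V(z) x (W − ε)` with `W > 2e^C γ/154`,
  `γ = 1/5`, and `V(z) ∼ 2Γ_G e^{−C}/log z`, i.e. any `C < 2/77`): the exceptional set is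
  `O(x^{9/10}) = o(x/log x)`.
* `card_P2_lower_of_theorem_quadratic`,
  `setOf_isAtMostAlmostPrime_two_sq_add_one_infinite_of_theorem_quadratic`: the general Theorem
  implies the first file's `card_P2_lower` (display (1) for `n² + 1`) and parity.S19.
* `siftedCountG`, `siftedCountG_buchstab`, `weightedSumG_eq`: the sieve data `S(𝒜_q, u)` of
  `𝒜 = {G(n) : 1 ≤ n ≤ x}`, Buchstab's identity, and identity (3) of Iwaniec = (2.5) of Lemke
  Oliver for general `G` (the first input of the §6 evaluation of `W(𝒜, z)`), PROVED exactly as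
  for `n² + 1` in the first file, with `x` replaced by the size parameter `X = Kx` in the weights.
* `infinite_setOf_isAtMostAlmostPrime_of_weightedSumG_pos`: the QUALITATIVE conclusion
  (`Ω(|G(n)|) ≤ 2` infinitely often) from any constant-free lower bound
  `W(𝒜_G, x^{1/5}) ≥ C x/log x`, `C > 0` — the form in which Lemke Oliver's argument ends
  ("`W(𝒜, z) ≫ x/log x`", p. 244).

What remains between this reduction and `theorem_quadratic_holds` is the hypothesis of
`theorem_quadratic_of_weightedSumG_lower`, i.e. §§2.2–3 of Lemke Oliver for a general `G`: the
bilinear-remainder linear sieve (`lemma2_bilinearSieve`), a level of distribution `x^{16/15}` in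
bilinear form for `𝒜_G` (Lemke Oliver's Lemmas 3, 4, 8: Hooley's method with `Γ⁰(fc₂)`-classes of
binary forms of discriminant `disc G`, Pell units when `disc G > 0`, and Weil's bound), Mertens'
theorem for `ρ_G` (Lemma 6, `L(ψ, 1) > 0`), and the §6 numerics — the general-`G` counterparts of
`IwaniecAlmostPrimesWeightedSum/…/Prop2Lower.lean`, which treat `n² + 1`.
-/

open Filter Finset Real Polynomial
open scoped ArithmeticFunction.Omega Polynomial Topology

noncomputable section

namespace Literature.NumberTheory.Sieve.Iwaniec1978

/-- Iwaniec's general quadratic `G = aX² + bX + c ∈ ℤ[X]` (p. 172), the polynomial of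
`theorem_quadratic`. [cite: IwaniecInventiones1978, Theorem p. 172] -/
abbrev quadPoly (a b c : ℤ) : ℤ[X] := C a * X ^ 2 + C b * X + C c

variable {a b c : ℤ}

/-- `G(n) = an² + bn + c`. [folklore] -/
@[simp] theorem eval_quadPoly (a b c n : ℤ) :
    (quadPoly a b c).eval n = a * n ^ 2 + b * n + c := by
  simp [quadPoly]

/-- `deg G = 2` for `a ≠ 0` (Mathlib's `natDegree_quadratic`). [folklore] -/
theorem natDegree_quadPoly (ha : a ≠ 0) : (quadPoly a b c).natDegree = 2 :=
  natDegree_quadratic ha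

/-- The leading coefficient of `G` is `a` (Mathlib's `leadingCoeff_quadratic`). [folklore] -/
theorem leadingCoeff_quadPoly (ha : a ≠ 0) : (quadPoly a b c).leadingCoeff = a :=
  leadingCoeff_quadratic ha

/-- An irreducible quadratic in `ℤ[X]` is primitive: no prime divides `a`, `b` and `c`
(Gauss; Mathlib's `Irreducible.isPrimitive`). [folklore] -/
theorem false_of_prime_dvd_coeffs (ha : a ≠ 0) (hirr : Irreducible (quadPoly a b c)) {p : ℕ}
    (hp : p.Prime) (hpa : (p : ℤ) ∣ a) (hpb : (p : ℤ) ∣ b) (hpc : (p : ℤ) ∣ c) : False := by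
  have hprim : (quadPoly a b c).IsPrimitive :=
    hirr.isPrimitive (by rw [natDegree_quadPoly ha]; decide)
  obtain ⟨a', rfl⟩ := hpa
  obtain ⟨b', rfl⟩ := hpb
  obtain ⟨c', rfl⟩ := hpc
  have hdvd : C (p : ℤ) ∣ quadPoly (p * a') (p * b') (p * c') :=
    ⟨quadPoly a' b' c', by simp only [quadPoly, map_mul]; ring⟩
  have hu : IsUnit (p : ℤ) := hprim _ hdvd
  rw [Int.isUnit_iff] at hu
  have := hp.one_lt
  omega

/-- An irreducible quadratic in `ℤ[X]` has no integer root. [folklore] -/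
theorem quadPoly_eval_ne_zero (ha : a ≠ 0) (hirr : Irreducible (quadPoly a b c)) (n : ℤ) :
    a * n ^ 2 + b * n + c ≠ 0 := by
  intro h0
  have hroot : IsRoot (quadPoly a b c) n := by
    simp [IsRoot, h0]
  have hfac := mul_divByMonic_eq_iff_isRoot.mpr hroot
  rcases hirr.isUnit_or_isUnit hfac.symm with hu | hu
  · exact not_isUnit_X_sub_C n hu
  · obtain ⟨u, hu', hu_eq⟩ := Polynomial.isUnit_iff.mp hu
    have hdeg := congrArg natDegree hfac
    rw [← hu_eq, natDegree_mul (X_sub_C_ne_zero n) (by simp [hu'.ne_zero]), natDegree_X_sub_C,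
      natDegree_C, natDegree_quadPoly ha] at hdeg
    omega

/-- Under Iwaniec's hypotheses (`a > 0`, `c` odd, `G` irreducible in `ℤ[X]`) `G` has no fixed
prime divisor: `G(0) = c` is odd, and for an odd prime `p`, `p ∣ G(0), G(1), G(−1)` would give
`p ∣ a, b, c`. [cite: IwaniecInventiones1978, §1 p. 171] -/
theorem exists_not_dvd_eval (ha : 0 < a) (hc : Odd c) (hirr : Irreducible (quadPoly a b c))
    {p : ℕ} (hp : p.Prime) :
    ∃ n ∈ Finset.range p, ¬ (p : ℤ) ∣ a * (n : ℤ) ^ 2 + b * n + c := by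
  by_cases h2 : p = 2
  · subst h2
    refine ⟨0, by simp, ?_⟩
    simp only [Nat.cast_zero, Nat.cast_ofNat]
    rw [show a * (0 : ℤ) ^ 2 + b * 0 + c = c by ring, ← even_iff_two_dvd]
    exact Int.not_even_iff_odd.mpr hc
  · have h3 : 3 ≤ p := by have := hp.two_le; omega
    have hP : Prime (p : ℤ) := Nat.prime_iff_prime_int.mp hp
    by_contra hall
    push Not at hall
    have h0 := hall 0 (Finset.mem_range.mpr hp.pos)
    have h1 := hall 1 (Finset.mem_range.mpr (by omega))
    have hm := hall (p - 1) (Finset.mem_range.mpr (by omega))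
    simp only [Nat.cast_zero, Nat.cast_one] at h0 h1
    rw [show a * (0 : ℤ) ^ 2 + b * 0 + c = c by ring] at h0
    rw [show a * (1 : ℤ) ^ 2 + b * 1 + c = a + b + c by ring] at h1
    have hm' : (p : ℤ) ∣ a - b + c := by
      have hcast : ((p - 1 : ℕ) : ℤ) = (p : ℤ) - 1 := by
        rw [Nat.cast_sub (by omega), Nat.cast_one]
      rw [hcast] at hm
      have e : a - b + c = (a * ((p : ℤ) - 1) ^ 2 + b * ((p : ℤ) - 1) + c) -
          (p : ℤ) * (a * p - 2 * a + b) := by ring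
      rw [e]
      exact dvd_sub hm (dvd_mul_right _ _)
    have h2a : (p : ℤ) ∣ 2 * a := by
      have e : 2 * a = (a + b + c) + (a - b + c) - 2 * c := by ring
      rw [e]; exact dvd_sub (dvd_add h1 hm') (dvd_mul_of_dvd_right h0 2)
    have h2b : (p : ℤ) ∣ 2 * b := by
      have e : 2 * b = (a + b + c) - (a - b + c) := by ring
      rw [e]; exact dvd_sub h1 hm'
    have hp2 : ¬ (p : ℤ) ∣ 2 := by
      intro h
      have := Int.le_of_dvd two_pos h
      omega
    have hpa : (p : ℤ) ∣ a := ((hP.dvd_or_dvd h2a).resolve_left hp2)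
    have hpb : (p : ℤ) ∣ b := ((hP.dvd_or_dvd h2b).resolve_left hp2)
    exact false_of_prime_dvd_coeffs ha.ne' hirr hp hpa hpb h0

/-- `ω_G(p) < p` for every prime `p` under Iwaniec's hypotheses.
[cite: IwaniecInventiones1978, §1 p. 171] -/
theorem polyRootCountMod_quadPoly_lt (ha : 0 < a) (hc : Odd c) (hirr : Irreducible (quadPoly a b c))
    {p : ℕ} (hp : p.Prime) : polyRootCountMod ![quadPoly a b c] p < p := by
  obtain ⟨n, hn, hndvd⟩ := exists_not_dvd_eval ha hc hirr hp
  unfold polyRootCountMod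
  simp only [Fin.prod_univ_one, Matrix.cons_val_fin_one, eval_quadPoly]
  calc ((Finset.range p).filter fun m : ℕ => (p : ℤ) ∣ a * (m : ℤ) ^ 2 + b * m + c).card
      < (Finset.range p).card := by
        refine Finset.card_lt_card ⟨Finset.filter_subset _ _, fun hsub => ?_⟩
        exact hndvd (Finset.mem_filter.mp (hsub hn)).2
    _ = p := Finset.card_range p

/-- **Iwaniec's hypotheses make `{G}` a Bateman–Horn system** (irreducible, positive leading
coefficient, no fixed prime divisor). [cite: IwaniecInventiones1978, §1 p. 171] -/
theorem isBatemanHornSystem_quadPoly (ha : 0 < a) (hc : Odd c)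
    (hirr : Irreducible (quadPoly a b c)) : IsBatemanHornSystem ![quadPoly a b c] where
  irreducible i := by
    fin_cases i
    exact hirr
  leadingCoeff_pos i := by
    fin_cases i
    show 0 < (quadPoly a b c).leadingCoeff
    rw [leadingCoeff_quadPoly ha.ne']
    exact ha
  pairwise_not_associated := Subsingleton.pairwise
  hasNoFixedPrimeDivisor p hp := polyRootCountMod_quadPoly_lt ha hc hirr hp

/-- Iwaniec's `Γ_G = (1/g) ∏_p (1 − ρ(p)/p)(1 − 1/p)⁻¹`, `g = 2`, i.e. one half of the Bateman–Horn
constant of `{G}` — the constant of display (1) and of `theorem_quadratic`.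
[cite: IwaniecInventiones1978, §1 p. 171] -/
def gammaG (a b c : ℤ) : ℝ := batemanHornConst ![quadPoly a b c] / 2

/-- `Γ_G > 0` under Iwaniec's hypotheses — PROVED from the tree's Bateman–Horn convergence theorem
(`IsBatemanHornSystem.hasBatemanHornConst_holds`). [cite: BatemanHornMathComp1962, pp. 364–365] -/
theorem gammaG_pos (ha : 0 < a) (hc : Odd c) (hirr : Irreducible (quadPoly a b c)) :
    0 < gammaG a b c :=
  div_pos (IsBatemanHornSystem.hasBatemanHornConst_holds
    (isBatemanHornSystem_quadPoly ha hc hirr)).2 two_pos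

/-! ### `p² ∣ G(n)`: at most two residue classes modulo `p²` for `p ∤ a·disc G` -/

/-- `G(m) − G(n) = (m − n)(a(m + n) + b)`. [folklore] -/
theorem quad_sub_quad (a b c m n : ℤ) :
    (a * m ^ 2 + b * m + c) - (a * n ^ 2 + b * n + c) = (m - n) * (a * (m + n) + b) := by ring

/-- `(2an + b)² − 4a G(n) = b² − 4ac`. [folklore] -/
theorem disc_eq (a b c n : ℤ) :
    (2 * a * n + b) ^ 2 - 4 * a * (a * n ^ 2 + b * n + c) = b ^ 2 - 4 * a * c := by ring

/-- For a prime `p ∤ b² − 4ac`: two solutions of `G ≡ 0 (mod p²)` that are incongruent modulo `p²`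
are conjugate, `p² ∣ a(m + n) + b` (Hensel: the roots modulo `p` are simple, so each lifts
uniquely). [folklore] -/
theorem sq_dvd_conj {p : ℕ} (hp : p.Prime) (hpd : ¬ (p : ℤ) ∣ b ^ 2 - 4 * a * c) {m n : ℤ}
    (hm : (p : ℤ) ^ 2 ∣ a * m ^ 2 + b * m + c) (hn : (p : ℤ) ^ 2 ∣ a * n ^ 2 + b * n + c)
    (hmn : ¬ (p : ℤ) ^ 2 ∣ m - n) : (p : ℤ) ^ 2 ∣ a * (m + n) + b := by
  have hP : Prime (p : ℤ) := Nat.prime_iff_prime_int.mp hp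
  have hprod : (p : ℤ) ^ 2 ∣ (m - n) * (a * (m + n) + b) := by
    rw [← quad_sub_quad]; exact dvd_sub hm hn
  by_cases h1 : (p : ℤ) ∣ m - n
  · exfalso
    obtain ⟨t, ht⟩ := h1
    have hpt : ¬ (p : ℤ) ∣ t := fun ⟨s, hs⟩ => hmn ⟨s, by rw [ht, hs]; ring⟩
    have hK : (p : ℤ) ∣ a * (m + n) + b := by
      have h' : (p : ℤ) * p ∣ (p : ℤ) * (t * (a * (m + n) + b)) := by
        rw [← sq, ← mul_assoc, ← ht]; exact hprod
      exact (hP.dvd_or_dvd ((mul_dvd_mul_iff_left hP.ne_zero).mp h')).resolve_left hpt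
    have h2an : (p : ℤ) ∣ 2 * a * n + b := by
      have e : 2 * a * n + b = (a * (m + n) + b) - a * (m - n) := by ring
      rw [e, ht]
      exact dvd_sub hK ((dvd_mul_right (p : ℤ) t).mul_left a)
    have hGn : (p : ℤ) ∣ a * n ^ 2 + b * n + c := (dvd_pow_self (p : ℤ) two_ne_zero).trans hn
    apply hpd
    rw [← disc_eq a b c n]
    exact dvd_sub (dvd_pow h2an two_ne_zero) (hGn.mul_left _)
  · have hcop : IsCoprime ((p : ℤ) ^ 2) (m - n) :=
      ((Prime.coprime_iff_not_dvd hP).mpr h1).pow_left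
    exact hcop.dvd_of_dvd_mul_left hprod

/-- For a prime `p ∤ a`, `p ∤ b² − 4ac`, there are at most `2(N/p² + 1)` integers `1 ≤ n ≤ N` with
`p² ∣ G(n)` (`ρ(p²) ≤ 2`, each root a residue class modulo `p²`).
[cite: IwaniecInventiones1978, §2 p. 173] -/
theorem card_filter_sq_dvd_quad_le {p : ℕ} (hp : p.Prime) (hpa : ¬ (p : ℤ) ∣ a)
    (hpd : ¬ (p : ℤ) ∣ b ^ 2 - 4 * a * c) (N : ℕ) :
    ((Finset.Icc 1 N).filter fun n : ℕ => (p : ℤ) ^ 2 ∣ a * (n : ℤ) ^ 2 + b * n + c).card ≤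
      2 * (N / p ^ 2 + 1) := by
  set T := (Finset.Icc 1 N).filter fun n : ℕ => (p : ℤ) ^ 2 ∣ a * (n : ℤ) ^ 2 + b * n + c
    with hT
  have hcast : ((p ^ 2 : ℕ) : ℤ) = (p : ℤ) ^ 2 := by push_cast; ring
  rcases T.eq_empty_or_nonempty with h0 | ⟨n₀, hn₀⟩
  · rw [h0]; simp
  have hn₀' := (Finset.mem_filter.mp hn₀).2
  set T₂ := T.filter fun n : ℕ => ¬ ((p ^ 2 : ℕ) : ℤ) ∣ (n : ℤ) - n₀ with hT₂
  have hsplit : T ⊆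
      ((Finset.Icc 1 N).filter fun n : ℕ => ((p ^ 2 : ℕ) : ℤ) ∣ (n : ℤ) - n₀) ∪ T₂ := by
    intro n hn
    rw [Finset.mem_union, Finset.mem_filter, hT₂, Finset.mem_filter]
    by_cases h : ((p ^ 2 : ℕ) : ℤ) ∣ (n : ℤ) - n₀
    · exact Or.inl ⟨(Finset.mem_filter.mp hn).1, h⟩
    · exact Or.inr ⟨hn, h⟩
  have hT₂le : T₂.card ≤ N / p ^ 2 + 1 := by
    rcases T₂.eq_empty_or_nonempty with h0 | ⟨m₀, hm₀⟩
    · rw [h0]; simp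
    have hm₀T := (Finset.mem_filter.mp hm₀).1
    have hm₀' := (Finset.mem_filter.mp hm₀T).2
    have hm₀n := (Finset.mem_filter.mp hm₀).2
    rw [hcast] at hm₀n
    have hconj₀ := sq_dvd_conj hp hpd hm₀' hn₀' hm₀n
    have hsub : T₂ ⊆ (Finset.Icc 1 N).filter fun n : ℕ => ((p ^ 2 : ℕ) : ℤ) ∣ (n : ℤ) - m₀ := by
      intro n hn
      have hnT := (Finset.mem_filter.mp hn).1
      have hn' := (Finset.mem_filter.mp hnT).2
      have hnn := (Finset.mem_filter.mp hn).2
      rw [hcast] at hnn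
      have hconj := sq_dvd_conj hp hpd hn' hn₀' hnn
      rw [Finset.mem_filter, hcast]
      refine ⟨(Finset.mem_filter.mp hnT).1, ?_⟩
      have hdiff : (p : ℤ) ^ 2 ∣ a * ((n : ℤ) - m₀) := by
        have e : a * ((n : ℤ) - m₀) = (a * ((n : ℤ) + n₀) + b) - (a * ((m₀ : ℤ) + n₀) + b) := by
          ring
        rw [e]; exact dvd_sub hconj hconj₀
      have hP : Prime (p : ℤ) := Nat.prime_iff_prime_int.mp hp
      exact (((Prime.coprime_iff_not_dvd hP).mpr hpa).pow_left).dvd_of_dvd_mul_left hdiff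
    exact (Finset.card_le_card hsub).trans (card_filter_Icc_modEq_le _ N _)
  calc T.card ≤ _ := Finset.card_le_card hsplit
    _ ≤ _ := Finset.card_union_le _ _
    _ ≤ (N / p ^ 2 + 1) + (N / p ^ 2 + 1) :=
        add_le_add (card_filter_Icc_modEq_le _ N _) hT₂le
    _ = 2 * (N / p ^ 2 + 1) := by ring

/-- An irreducible quadratic in `ℤ[X]` has nonzero discriminant (otherwise
`G = a(X + b/2a)²` in `ℚ[X]`, contradicting Gauss's lemma). [folklore] -/
theorem disc_ne_zero (ha : a ≠ 0) (hirr : Irreducible (quadPoly a b c)) :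
    b ^ 2 - 4 * a * c ≠ 0 := by
  intro hd
  have hprim : (C a * X ^ 2 + C b * X + C c : ℤ[X]).IsPrimitive :=
    hirr.isPrimitive (by rw [natDegree_quadratic ha]; decide)
  have hirrQ : Irreducible ((C a * X ^ 2 + C b * X + C c : ℤ[X]).map (algebraMap ℤ ℚ)) :=
    (hprim.irreducible_iff_irreducible_map_fraction_map (K := ℚ)).mp hirr
  have haQ : (a : ℚ) ≠ 0 := by exact_mod_cast ha
  set β : ℚ := (b : ℚ) / (2 * a) with hβ
  have hbQ : (b : ℚ) = 2 * a * β := by rw [hβ]; field_simp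
  have hcQ : (c : ℚ) = a * β ^ 2 := by
    have hd' : (b : ℚ) ^ 2 = 4 * a * c := by exact_mod_cast (sub_eq_zero.mp hd)
    have h4a : (4 : ℚ) * a ≠ 0 := mul_ne_zero four_ne_zero haQ
    calc (c : ℚ) = 4 * a * c / (4 * a) := by field_simp
      _ = (b : ℚ) ^ 2 / (4 * a) := by rw [hd']
      _ = a * β ^ 2 := by rw [hβ]; field_simp; ring
  have hmap : (C a * X ^ 2 + C b * X + C c : ℤ[X]).map (algebraMap ℤ ℚ) =
      (C (a : ℚ) * (X + C β)) * (X + C β) := by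
    have h1 : (C a * X ^ 2 + C b * X + C c : ℤ[X]).map (algebraMap ℤ ℚ) =
        C (a : ℚ) * X ^ 2 + C (b : ℚ) * X + C (c : ℚ) := by
      simp only [Polynomial.map_add, Polynomial.map_mul, Polynomial.map_pow, map_C, map_X,
        algebraMap_int_eq, Int.coe_castRingHom]
    rw [h1, hbQ, hcQ]
    simp only [map_mul, map_pow, C_ofNat]
    ring
  rw [hmap] at hirrQ
  rcases hirrQ.isUnit_or_isUnit rfl with hu | hu
  · have h := natDegree_eq_zero_of_isUnit hu
    rw [natDegree_C_mul haQ, natDegree_X_add_C] at h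
    exact one_ne_zero h
  · have h := natDegree_eq_zero_of_isUnit hu
    rw [natDegree_X_add_C] at h
    exact one_ne_zero h

/-! ### The sequence `𝒜 = {G(n) : 1 ≤ n ≤ x}` and Richert's weighted sum for general `G` -/

/-- `|G(n)|` as a natural number: the member of `𝒜 = {G(n) : 1 ≤ n ≤ x}` indexed by `n`
(`G(n) > 0` for all but finitely many `n` since `a > 0`; `theorem_quadratic` reads "`G(n) = P₂`"
through `Int.natAbs`). [cite: IwaniecInventiones1978, §2 p. 173] -/
def gAbs (a b c : ℤ) (n : ℕ) : ℕ := (a * (n : ℤ) ^ 2 + b * n + c).natAbs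

/-- The size constant `K = a + |b| + |c|`: `|G(n)| ≤ K x²` for `1 ≤ n ≤ x`, so every member of
`𝒜` is at most `X²` with `X = K x`, the size parameter of the weights below. [folklore] -/
def sizeK (a b c : ℤ) : ℤ := a + |b| + |c|

/-- `K = a + |b| + |c| ≥ 1` for `a > 0`. [folklore] -/
theorem one_le_sizeK (ha : 0 < a) : (1 : ℝ) ≤ (sizeK a b c : ℝ) := by
  have h : (1 : ℤ) ≤ sizeK a b c := by
    unfold sizeK
    have := abs_nonneg b
    have := abs_nonneg c
    omega
  exact_mod_cast h

/-- `|G(n)| ≤ K x²` for `0 ≤ n ≤ x`, `x ≥ 1`. [folklore] -/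
theorem gAbs_le (ha : 0 < a) {n : ℕ} {x : ℝ} (hx : 1 ≤ x) (hn : (n : ℝ) ≤ x) :
    (gAbs a b c n : ℝ) ≤ (sizeK a b c : ℝ) * x ^ 2 := by
  unfold gAbs sizeK
  rw [Nat.cast_natAbs]
  push_cast
  have hn0 : (0 : ℝ) ≤ n := Nat.cast_nonneg n
  have ha' : (0 : ℝ) < a := by exact_mod_cast ha
  have h1 : |(a : ℝ) * (n : ℝ) ^ 2 + b * n + c| ≤ a * (n : ℝ) ^ 2 + |(b : ℝ)| * n + |(c : ℝ)| := by
    calc |(a : ℝ) * (n : ℝ) ^ 2 + b * n + c| ≤ |(a : ℝ) * (n : ℝ) ^ 2 + b * n| + |(c : ℝ)| :=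
          abs_add_le _ _
      _ ≤ |(a : ℝ) * (n : ℝ) ^ 2| + |(b : ℝ) * n| + |(c : ℝ)| := by
          gcongr; exact abs_add_le _ _
      _ = a * (n : ℝ) ^ 2 + |(b : ℝ)| * n + |(c : ℝ)| := by
          rw [abs_mul, abs_mul, abs_of_pos ha', abs_of_nonneg (sq_nonneg _), abs_of_nonneg hn0]
  have h2 : (a : ℝ) * (n : ℝ) ^ 2 + |(b : ℝ)| * n + |(c : ℝ)| ≤
      (a + |(b : ℝ)| + |(c : ℝ)|) * x ^ 2 := by
    have hb0 : 0 ≤ |(b : ℝ)| := abs_nonneg _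
    have hc0 : 0 ≤ |(c : ℝ)| := abs_nonneg _
    have hnx2 : (n : ℝ) ^ 2 ≤ x ^ 2 := by gcongr
    have hx2 : x ≤ x ^ 2 := by nlinarith
    have h12 : (1 : ℝ) ≤ x ^ 2 := by nlinarith
    nlinarith [mul_le_mul_of_nonneg_left hnx2 ha'.le, mul_le_mul_of_nonneg_left (hn.trans hx2) hb0,
      mul_le_mul_of_nonneg_left h12 hc0]
  exact h1.trans h2

open scoped Classical in
/-- Richert's weighted sum `W(𝒜, z) = ∑_{a ∈ 𝒜, (a, P(z)) = 1} w(a)` for `𝒜 = {G(n) : 1 ≤ n ≤ x}`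
(Iwaniec (2), p. 173; Lemke Oliver (2.3), p. 244), with the weight at `λ = 2` relative to the size
parameter `X = K x` (`X² ≥ |G(n)|` on `[1, x]`; Lemke Oliver's thresholds `x^{λ/4}, x^{λ/2}` with
`x^{λ/2} = X`, i.e. `λ = 2 + 2 log K/log x → 2`).
[cite: LemkeOliverActaArith2012, §2.1 (2.2)–(2.3)] -/
def weightedSumG (a b c : ℤ) (x z : ℝ) : ℝ :=
  ∑ n ∈ (Finset.Icc 1 ⌊x⌋₊).filter
      (fun n : ℕ => Nat.Coprime (gAbs a b c n) (primesProdBelow z)),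
    richertWeight 2 ((sizeK a b c : ℝ) * x) (gAbs a b c n)

/-! ### Non-squarefree members of `𝒜` coprime to `P(z)` that are not `P₂` — PROVED bound -/

open scoped Classical in
/-- **Lemke Oliver p. 244 / Iwaniec §2 p. 173, for general `G` — PROVED (explicit constant).**
For `x ≥ 1`, `z ≥ 2`, `z > a`, `z > |b² − 4ac|`:
`#{1 ≤ n ≤ x : (G(n), P(z)) = 1, |G(n)| not squarefree, |G(n)| ≠ P₂} ≤ (4 + 2K) x/√z`,
`K = a + |b| + |c|`.
(If `p² ∣ G(n)` with all prime factors of `G(n)` at least `z` and `|G(n)| ≠ p²`, then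
`p² z ≤ |G(n)| ≤ K x²`, so `z ≤ p ≤ x √(K/z)`; each such `p ∤ a (b² − 4ac)` contributes at most
`2(x/p² + 1)` values of `n` (`card_filter_sq_dvd_quad_le`), and `∑_{p ≥ z} p⁻² ≤ 2/z`.)
[cite: LemkeOliverActaArith2012, §2.1 p. 244] -/
theorem card_exceptional_le (ha : 0 < a) (hirr : Irreducible (quadPoly a b c))
    {x z : ℝ} (hx : 1 ≤ x) (hz : 2 ≤ z) (hza : (a : ℝ) < z)
    (hzd : ((|b ^ 2 - 4 * a * c| : ℤ) : ℝ) < z) :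
    ((((Finset.Icc 1 ⌊x⌋₊).filter fun n : ℕ =>
        Nat.Coprime (gAbs a b c n) (primesProdBelow z) ∧ ¬ Squarefree (gAbs a b c n) ∧
          ¬ Nat.IsAtMostAlmostPrime 2 (gAbs a b c n))).card : ℝ) ≤
      (4 + 2 * (sizeK a b c : ℝ)) * x / Real.sqrt z := by
  set X := ⌊x⌋₊ with hX
  set Kr : ℝ := (sizeK a b c : ℝ) with hKr
  have hK1 : 1 ≤ Kr := one_le_sizeK ha
  set N := (Finset.Icc 1 X).filter fun n : ℕ =>
        Nat.Coprime (gAbs a b c n) (primesProdBelow z) ∧ ¬ Squarefree (gAbs a b c n) ∧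
          ¬ Nat.IsAtMostAlmostPrime 2 (gAbs a b c n) with hN
  set B := ⌊x * Real.sqrt (Kr / z)⌋₊ with hB
  set S := (Finset.Icc ⌈z⌉₊ B).filter Nat.Prime with hS
  have hz0 : 0 < z := by linarith
  have hx0 : 0 < x := by linarith
  have hXx : (X : ℝ) ≤ x := Nat.floor_le hx0.le
  -- Step 1: `N` is covered by the progressions `p² ∣ G(n)`, `p ∈ S`.
  have hcover : N ⊆ S.biUnion fun p => (Finset.Icc 1 X).filter fun n : ℕ =>
      (p : ℤ) ^ 2 ∣ a * (n : ℤ) ^ 2 + b * n + c := by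
    intro n hn
    rw [Finset.mem_filter, Finset.mem_Icc] at hn
    obtain ⟨⟨hn1, hnX⟩, hcop, hnsf, hnP2⟩ := hn
    have hG0 : gAbs a b c n ≠ 0 := by
      unfold gAbs
      exact Int.natAbs_ne_zero.mpr (quadPoly_eval_ne_zero ha.ne' hirr n)
    rw [Nat.squarefree_iff_prime_squarefree] at hnsf
    simp only [not_forall, not_not] at hnsf
    obtain ⟨p, hp, hpp⟩ := hnsf
    have hge : ∀ q : ℕ, q.Prime → q ∣ gAbs a b c n → z ≤ q := by
      intro q hq hqd
      by_contra hlt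
      rw [not_le] at hlt
      have hqP : q ∣ primesProdBelow z := (dvd_primesProdBelow_iff hq z).mpr hlt
      have hq1 : q ∣ Nat.gcd (gAbs a b c n) (primesProdBelow z) := Nat.dvd_gcd hqd hqP
      rw [hcop.gcd_eq_one] at hq1
      exact hq.one_lt.ne' (Nat.dvd_one.mp hq1)
    have hpz : z ≤ p := hge p hp (dvd_trans (dvd_mul_right p p) hpp)
    rw [Finset.mem_biUnion]
    refine ⟨p, ?_, ?_⟩
    · rw [Finset.mem_filter, Finset.mem_Icc]
      refine ⟨⟨Nat.ceil_le.mpr hpz, ?_⟩, hp⟩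
      obtain ⟨l, hl⟩ := hpp
      have hl1 : l ≠ 1 := by
        intro hl1
        rw [hl1, mul_one] at hl
        apply hnP2
        rw [hl, ← sq]
        exact (hp.sq_isAlmostPrime_two).isAtMost le_rfl
      have hl0 : l ≠ 0 := by
        intro h0
        rw [h0, mul_zero] at hl
        exact hG0 hl
      have hlz : z ≤ l := by
        have hml : (l.minFac).Prime := Nat.minFac_prime hl1
        have hmd : l.minFac ∣ gAbs a b c n := hl ▸ dvd_mul_of_dvd_right (Nat.minFac_dvd l) _
        exact (hge _ hml hmd).trans (by exact_mod_cast Nat.minFac_le (Nat.pos_of_ne_zero hl0))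
      have h1 : (p : ℝ) * p * z ≤ (gAbs a b c n : ℝ) := by
        have e : ((gAbs a b c n : ℕ) : ℝ) = (p : ℝ) * p * l := by exact_mod_cast hl
        rw [e]
        exact mul_le_mul_of_nonneg_left hlz (by positivity)
      have hnx : (n : ℝ) ≤ x := le_trans (by exact_mod_cast hnX) hXx
      have h2 : (gAbs a b c n : ℝ) ≤ Kr * x ^ 2 := gAbs_le ha hx hnx
      apply Nat.le_floor
      have hrhs : 0 ≤ x * Real.sqrt (Kr / z) := by positivity
      refine (pow_le_pow_iff_left₀ (by positivity) hrhs two_ne_zero).mp ?_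
      rw [mul_pow, Real.sq_sqrt (by positivity), mul_div_assoc', le_div_iff₀ hz0]
      nlinarith [h1, h2]
    · rw [Finset.mem_filter, Finset.mem_Icc]
      refine ⟨⟨hn1, hnX⟩, ?_⟩
      have : ((p * p : ℕ) : ℤ) ∣ a * (n : ℤ) ^ 2 + b * n + c := Int.natCast_dvd.mpr hpp
      simpa [sq] using this
  -- Step 2: count, using `ρ(p²) ≤ 2` for the primes `p ≥ z > a, |disc|`.
  have hdisc : b ^ 2 - 4 * a * c ≠ 0 := disc_ne_zero ha.ne' hirr
  have hcard : (N.card : ℝ) ≤ ∑ p ∈ S, 2 * ((X : ℝ) / (p : ℝ) ^ 2 + 1) := by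
    have h1 : N.card ≤ ∑ p ∈ S, 2 * (X / p ^ 2 + 1) :=
      calc N.card ≤ (S.biUnion fun p => (Finset.Icc 1 X).filter fun n : ℕ =>
              (p : ℤ) ^ 2 ∣ a * (n : ℤ) ^ 2 + b * n + c).card := Finset.card_le_card hcover
        _ ≤ ∑ p ∈ S, ((Finset.Icc 1 X).filter fun n : ℕ =>
              (p : ℤ) ^ 2 ∣ a * (n : ℤ) ^ 2 + b * n + c).card := Finset.card_biUnion_le
        _ ≤ ∑ p ∈ S, 2 * (X / p ^ 2 + 1) := by
            refine Finset.sum_le_sum fun p hp => ?_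
            have hp' := Finset.mem_filter.mp hp
            have hpz : z ≤ (p : ℝ) := by
              have := (Finset.mem_Icc.mp hp'.1).1
              exact (Nat.ceil_le).mp this
            have hp0 : (0 : ℤ) < p := by exact_mod_cast hp'.2.pos
            have hpa : ¬ (p : ℤ) ∣ a := by
              intro h
              have h1 : (p : ℤ) ≤ a := Int.le_of_dvd ha h
              have h2 : ((p : ℤ) : ℝ) ≤ (a : ℝ) := by exact_mod_cast h1
              push_cast at h2
              linarith
            have hpd : ¬ (p : ℤ) ∣ b ^ 2 - 4 * a * c := by
              intro h
              have h1 : (p : ℤ) ≤ |b ^ 2 - 4 * a * c| :=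
                Int.le_of_dvd (abs_pos.mpr hdisc) ((dvd_abs _ _).mpr h)
              have h2 : ((p : ℤ) : ℝ) ≤ ((|b ^ 2 - 4 * a * c| : ℤ) : ℝ) := by exact_mod_cast h1
              push_cast at h2 hzd
              linarith
            exact card_filter_sq_dvd_quad_le hp'.2 hpa hpd X
    have h2 : ((∑ p ∈ S, 2 * (X / p ^ 2 + 1) : ℕ) : ℝ) ≤
        ∑ p ∈ S, 2 * ((X : ℝ) / (p : ℝ) ^ 2 + 1) := by
      push_cast
      refine Finset.sum_le_sum fun p _ => ?_
      gcongr
      rw [← Nat.cast_pow]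
      exact Nat.cast_div_le
    exact le_trans (by exact_mod_cast h1) h2
  -- Step 3: evaluate the sum: `∑_{p ∈ S} p⁻² ≤ 2/z` and `#S ≤ B ≤ x √(K/z)`.
  have hceil2 : 2 ≤ ⌈z⌉₊ := by
    have : (2 : ℝ) ≤ ⌈z⌉₊ := hz.trans (Nat.le_ceil z)
    exact_mod_cast this
  set k := ⌈z⌉₊ - 1 with hk
  have hk0 : k ≠ 0 := by omega
  have hkz : z / 2 ≤ (k : ℝ) := by
    have h1 : (k : ℝ) = (⌈z⌉₊ : ℝ) - 1 := by
      rw [hk, Nat.cast_sub (by omega : 1 ≤ ⌈z⌉₊), Nat.cast_one]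
    rw [h1]
    have := Nat.le_ceil z
    linarith
  have hsumS : ∑ p ∈ S, ((p : ℝ) ^ 2)⁻¹ ≤ 2 / z := by
    have hsub : S ⊆ Finset.Ioc k (max k B) := by
      intro p hp
      rw [Finset.mem_filter, Finset.mem_Icc] at hp
      rw [Finset.mem_Ioc]
      exact ⟨by omega, le_max_of_le_right hp.1.2⟩
    calc ∑ p ∈ S, ((p : ℝ) ^ 2)⁻¹ ≤ ∑ i ∈ Finset.Ioc k (max k B), ((i : ℝ) ^ 2)⁻¹ :=
          Finset.sum_le_sum_of_subset_of_nonneg hsub fun i _ _ => by positivity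
      _ ≤ (k : ℝ)⁻¹ - ((max k B : ℕ) : ℝ)⁻¹ := sum_Ioc_inv_sq_le_sub hk0 (le_max_left k B)
      _ ≤ (k : ℝ)⁻¹ := by
          have : (0 : ℝ) ≤ ((max k B : ℕ) : ℝ)⁻¹ := by positivity
          linarith
      _ ≤ (z / 2)⁻¹ := inv_anti₀ (by positivity) hkz
      _ = 2 / z := inv_div z 2
  have hcardS : (S.card : ℝ) ≤ x * Real.sqrt (Kr / z) := by
    have h1 : S.card ≤ B := by
      calc S.card ≤ (Finset.Icc ⌈z⌉₊ B).card := Finset.card_filter_le _ _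
        _ = B + 1 - ⌈z⌉₊ := Nat.card_Icc _ _
        _ ≤ B := by omega
    calc (S.card : ℝ) ≤ B := by exact_mod_cast h1
      _ ≤ x * Real.sqrt (Kr / z) := Nat.floor_le (by positivity)
  have hsum_eq : ∑ p ∈ S, 2 * ((X : ℝ) / (p : ℝ) ^ 2 + 1) =
      2 * (X : ℝ) * ∑ p ∈ S, ((p : ℝ) ^ 2)⁻¹ + 2 * S.card := by
    have h : ∀ p ∈ S, 2 * ((X : ℝ) / (p : ℝ) ^ 2 + 1) = 2 * (X : ℝ) * ((p : ℝ) ^ 2)⁻¹ + 2 :=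
      fun p _ => by ring
    rw [Finset.sum_congr rfl h, Finset.sum_add_distrib, Finset.sum_const, ← Finset.mul_sum,
      nsmul_eq_mul, mul_comm (S.card : ℝ) 2]
  -- Step 4: numerics, `4X/z + 2x√(K/z) ≤ (4 + 2K) x/√z`.
  set s := Real.sqrt z with hs
  have hs0 : 0 < s := Real.sqrt_pos.mpr hz0
  have hs2 : s ^ 2 = z := Real.sq_sqrt hz0.le
  have hsz : s ≤ z := by nlinarith
  have hsqK : Real.sqrt (Kr / z) = Real.sqrt Kr / s := Real.sqrt_div (by linarith) z
  have hKK : Real.sqrt Kr ≤ Kr := by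
    rw [Real.sqrt_le_left (by linarith)]
    nlinarith
  have hp1 : 2 * (X : ℝ) * ∑ p ∈ S, ((p : ℝ) ^ 2)⁻¹ ≤ 4 * x / s := by
    calc 2 * (X : ℝ) * ∑ p ∈ S, ((p : ℝ) ^ 2)⁻¹ ≤ 2 * x * (2 / z) := by
          gcongr
      _ = 4 * x / z := by ring
      _ ≤ 4 * x / s := div_le_div_of_nonneg_left (by positivity) hs0 hsz
  have hp2 : 2 * (S.card : ℝ) ≤ 2 * Kr * x / s := by
    calc 2 * (S.card : ℝ) ≤ 2 * (x * Real.sqrt (Kr / z)) := by gcongr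
      _ = 2 * Real.sqrt Kr * x / s := by rw [hsqK]; ring
      _ ≤ 2 * Kr * x / s := by gcongr
  calc (N.card : ℝ) ≤ _ := hcard
    _ = _ := hsum_eq
    _ ≤ 4 * x / s + 2 * Kr * x / s := add_le_add hp1 hp2
    _ = (4 + 2 * Kr) * x / s := by ring

/-! ### `#{n ≤ x : G(n) = P₂} ≥ W(𝒜, z) − (exceptional set)` — PROVED -/

open scoped Classical in
/-- **Lemke Oliver §2.1 / Iwaniec p. 173, `#{a ∈ 𝒜 : a = P₂} ≥ ∑' w(a)`, general `G` — PROVED.**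
For `x > 1`, `z ≥ 2`, `z > a`, `z > |b² − 4ac|`:
`W(𝒜, z) ≤ #{1 ≤ n ≤ x : Ω(|G(n)|) ≤ 2} + (4 + 2K) x/√z`.  (Each weight is `≤ 1`; a positive weight
at `a = |G(n)| ≤ X²` forces `ω(a) ≤ 2` by Lemma 1 with `λ = 2` and size parameter `X = Kx`; then
`a` is squarefree (`Ω = ω ≤ 2`), or `a = p²`, or `a` lies in the exceptional set of
`card_exceptional_le`.) [cite: LemkeOliverActaArith2012, §2.1 pp. 243–244] -/
theorem weightedSumG_le_card (ha : 0 < a) (hirr : Irreducible (quadPoly a b c)) {x z : ℝ}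
    (hx : 1 < x) (hz : 2 ≤ z) (hza : (a : ℝ) < z) (hzd : ((|b ^ 2 - 4 * a * c| : ℤ) : ℝ) < z) :
    weightedSumG a b c x z ≤
      (((Finset.Icc 1 ⌊x⌋₊).filter fun n : ℕ => Nat.IsAtMostAlmostPrime 2 (gAbs a b c n)).card : ℝ)
        + (4 + 2 * (sizeK a b c : ℝ)) * x / Real.sqrt z := by
  unfold weightedSumG
  set Kr : ℝ := (sizeK a b c : ℝ) with hKr
  have hK1 : 1 ≤ Kr := one_le_sizeK ha
  set Xs : ℝ := Kr * x with hXs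
  have hXs1 : 1 < Xs := by rw [hXs]; nlinarith
  set F := (Finset.Icc 1 ⌊x⌋₊).filter (fun n : ℕ => Nat.Coprime (gAbs a b c n) (primesProdBelow z))
    with hF
  set P := (Finset.Icc 1 ⌊x⌋₊).filter (fun n : ℕ => Nat.IsAtMostAlmostPrime 2 (gAbs a b c n))
    with hP
  set N := (Finset.Icc 1 ⌊x⌋₊).filter fun n : ℕ =>
      Nat.Coprime (gAbs a b c n) (primesProdBelow z) ∧ ¬ Squarefree (gAbs a b c n) ∧
        ¬ Nat.IsAtMostAlmostPrime 2 (gAbs a b c n) with hN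
  have hNle : (N.card : ℝ) ≤ (4 + 2 * Kr) * x / Real.sqrt z :=
    card_exceptional_le ha hirr hx.le hz hza hzd
  set F₂ := F.filter fun n : ℕ => 0 < richertWeight 2 Xs (gAbs a b c n) with hF₂
  have h1 : ∑ n ∈ F, richertWeight 2 Xs (gAbs a b c n) ≤
      ∑ n ∈ F, (if 0 < richertWeight 2 Xs (gAbs a b c n) then (1 : ℝ) else 0) := by
    refine Finset.sum_le_sum fun n _ => ?_
    split_ifs with h
    · exact richertWeight_le_one (by norm_num) hXs1 _
    · exact not_lt.mp h
  have h2 : ∑ n ∈ F, (if 0 < richertWeight 2 Xs (gAbs a b c n) then (1 : ℝ) else 0) = F₂.card := by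
    rw [Finset.sum_boole]
  have hx0 : 0 < x := by linarith
  have h3 : F₂ ⊆ P ∪ N := by
    intro n hn
    rw [hF₂, hF, Finset.mem_filter, Finset.mem_filter, Finset.mem_Icc] at hn
    obtain ⟨⟨⟨hn1, hnx⟩, hcop⟩, hw⟩ := hn
    rw [Finset.mem_union]
    have hG0 : gAbs a b c n ≠ 0 :=
      Int.natAbs_ne_zero.mpr (quadPoly_eval_ne_zero ha.ne' hirr n)
    have hnx' : (n : ℝ) ≤ x := (Nat.cast_le.mpr hnx).trans (Nat.floor_le hx0.le)
    have hle : ((gAbs a b c n : ℕ) : ℝ) ≤ Xs ^ (2 : ℝ) := by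
      rw [Real.rpow_two, hXs]
      calc ((gAbs a b c n : ℕ) : ℝ) ≤ Kr * x ^ 2 := gAbs_le ha hx.le hnx'
        _ ≤ (Kr * x) ^ 2 := by
            rw [mul_pow]
            have : Kr ≤ Kr ^ 2 := by nlinarith
            have hx2 : 0 ≤ x ^ 2 := sq_nonneg x
            nlinarith
    have hω := cardDistinctFactors_le_two_of_richertWeight_pos (lam := 2) le_rfl (by norm_num)
      hXs1 hG0 hle hw
    by_cases hP2 : Nat.IsAtMostAlmostPrime 2 (gAbs a b c n)
    · left
      rw [hP, Finset.mem_filter, Finset.mem_Icc]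
      exact ⟨⟨hn1, hnx⟩, hP2⟩
    · right
      rw [hN, Finset.mem_filter, Finset.mem_Icc]
      refine ⟨⟨hn1, hnx⟩, hcop, ?_, hP2⟩
      intro hsf
      apply hP2
      refine ⟨hG0, ?_⟩
      rw [← (ArithmeticFunction.cardDistinctFactors_eq_cardFactors_iff_squarefree hG0).mpr hsf]
      exact hω
  have h4 : (F₂.card : ℝ) ≤ P.card + N.card := by
    have : F₂.card ≤ P.card + N.card :=
      calc F₂.card ≤ (P ∪ N).card := Finset.card_le_card h3
        _ ≤ P.card + N.card := Finset.card_union_le _ _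
    exact_mod_cast this
  calc ∑ n ∈ F, richertWeight 2 Xs (gAbs a b c n) ≤ F₂.card := h1.trans_eq h2
    _ ≤ P.card + N.card := h4
    _ ≤ P.card + (4 + 2 * Kr) * x / Real.sqrt z := by linarith

/-! ### The Theorem from the weighted-sieve lower bound (2) for general `G` — PROVED reduction -/

open scoped Classical in
/-- **Reduction of Iwaniec's Theorem (general quadratic, display (1)) to the weighted-sieve lower
bound (2) — PROVED.**  Suppose that for every `G = aX² + bX + c` as in the Theorem there is a
constant `C > 1/77` with `W(𝒜_G, x^{1/5}) ≥ C Γ_G x/log x` for all large `x` (Iwaniec's (2),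
p. 173, with `z = x^γ`, `γ = 1/5`, p. 187: `W(𝒜, z) > V(z) x (W − ε)`, `W > 2e^C γ/154`, and
`V(z) ∼ 2Γ_G e^{−C}/log z`; the content of §§3–6 / Lemke Oliver §§2.2–3).  Then
`theorem_quadratic` holds: by `weightedSumG_le_card` the count of `n ≤ x` with `Ω(|G(n)|) ≤ 2`
is at least `C Γ_G x/log x − (4 + 2K) x^{9/10} > (Γ_G/77) x/log x` for large `x`
(`log x = o(x^{1/10})`, `Γ_G > 0` by `gammaG_pos`), and in particular it is unbounded.
[cite: IwaniecInventiones1978, §2 p. 173 (2) and §6 p. 187] -/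
theorem theorem_quadratic_of_weightedSumG_lower
    (h : ∀ a b c : ℤ, 0 < a → Odd c → Irreducible (quadPoly a b c) →
      ∃ C : ℝ, 1 / 77 < C ∧ ∀ᶠ x : ℝ in atTop,
        C * gammaG a b c * x / Real.log x ≤ weightedSumG a b c x (x ^ (1 / 5 : ℝ))) :
    theorem_quadratic := by
  intro a b c ha hc hirr
  obtain ⟨C₀, hC₀, hW⟩ := h a b c ha hc hirr
  have hΓ : 0 < gammaG a b c := gammaG_pos ha hc hirr
  set Γ := gammaG a b c with hΓdef
  set Kr : ℝ := (sizeK a b c : ℝ) with hKr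
  have hK1 : 1 ≤ Kr := one_le_sizeK ha
  -- the quantitative statement
  have hquant : ∀ᶠ x : ℝ in atTop, Γ / 77 * x / Real.log x <
      (((Finset.Icc 1 ⌊x⌋₊).filter fun n : ℕ =>
        Nat.IsAtMostAlmostPrime 2 (gAbs a b c n)).card : ℝ) := by
    set δ : ℝ := (C₀ - 1 / 77) * Γ / (5 + 2 * Kr) with hδ
    have hδ0 : 0 < δ := by
      have : 0 < C₀ - 1 / 77 := by linarith
      positivity
    have hlog : ∀ᶠ x : ℝ in atTop, ‖Real.log x‖ ≤ δ * ‖x ^ (1 / 10 : ℝ)‖ :=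
      (Asymptotics.isLittleO_iff.mp
        (isLittleO_log_rpow_atTop (by norm_num : (0 : ℝ) < 1 / 10))) hδ0
    set x₀ : ℝ := ((a + |b ^ 2 - 4 * a * c| + 2 : ℤ) : ℝ) ^ (5 : ℕ) with hx₀
    filter_upwards [hW, hlog, eventually_ge_atTop x₀, eventually_ge_atTop (32 : ℝ)] with
      x hWx hlogx hxx₀ hx32
    have hx1 : 1 < x := by linarith
    have hx0 : 0 < x := by linarith
    set u : ℝ := x ^ (1 / 10 : ℝ) with hu
    have hu1 : 1 ≤ u := Real.one_le_rpow hx1.le (by norm_num)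
    have hu0 : 0 < u := by linarith
    have hxu : u ^ 10 = x := by
      rw [hu, ← Real.rpow_mul_natCast hx0.le]; norm_num
    have hz2 : x ^ (1 / 5 : ℝ) = u ^ 2 := by
      rw [hu, ← Real.rpow_mul_natCast hx0.le]; norm_num
    have hsqrt : Real.sqrt (x ^ (1 / 5 : ℝ)) = u := by
      rw [hz2, Real.sqrt_sq hu0.le]
    -- the thresholds for `z = x^{1/5}`
    set T : ℝ := ((a + |b ^ 2 - 4 * a * c| + 2 : ℤ) : ℝ) with hT
    have hT2 : 2 ≤ T := by
      have : (2 : ℤ) ≤ a + |b ^ 2 - 4 * a * c| + 2 := by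
        have := abs_nonneg (b ^ 2 - 4 * a * c); omega
      rw [hT]; exact_mod_cast this
    have hTz : T ≤ x ^ (1 / 5 : ℝ) := by
      have h5 : T ^ (5 : ℕ) ≤ x := hxx₀
      have hT0 : 0 ≤ T := by linarith
      calc T = (T ^ (5 : ℕ)) ^ (1 / 5 : ℝ) := by
            rw [← Real.rpow_natCast, ← Real.rpow_mul hT0]; norm_num
        _ ≤ x ^ (1 / 5 : ℝ) := Real.rpow_le_rpow (by positivity) h5 (by norm_num)
    have h2z : (2 : ℝ) ≤ x ^ (1 / 5 : ℝ) := hT2.trans hTz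
    have hza : (a : ℝ) < x ^ (1 / 5 : ℝ) := by
      have : (a : ℝ) < T := by
        rw [hT]; push_cast
        have := abs_nonneg ((b : ℝ) ^ 2 - 4 * a * c)
        linarith
      exact this.trans_le hTz
    have hzd : ((|b ^ 2 - 4 * a * c| : ℤ) : ℝ) < x ^ (1 / 5 : ℝ) := by
      have : ((|b ^ 2 - 4 * a * c| : ℤ) : ℝ) < T := by
        rw [hT]; push_cast
        have : (0 : ℝ) < a := by exact_mod_cast ha
        linarith
      exact this.trans_le hTz
    have hWle := weightedSumG_le_card ha hirr hx1 h2z hza hzd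
    rw [hsqrt] at hWle
    -- `log x ≤ δ u`, so `(C₀ − 1/77) Γ x / log x ≥ (5 + 2K) x / u > (4 + 2K) x / u`.
    have hL0 : 0 < Real.log x := Real.log_pos hx1
    have hLu : Real.log x ≤ δ * u := by
      rw [Real.norm_eq_abs, Real.norm_eq_abs, abs_of_nonneg hL0.le,
        abs_of_nonneg (Real.rpow_nonneg hx0.le _)] at hlogx
      exact hlogx
    have hkey : (4 + 2 * Kr) * x / u < (C₀ - 1 / 77) * Γ * x / Real.log x := by
      have h45 : (4 + 2 * Kr) * x / u < (5 + 2 * Kr) * x / u := by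
        gcongr; norm_num
      refine h45.trans_le ?_
      rw [div_le_div_iff₀ hu0 hL0]
      calc (5 + 2 * Kr) * x * Real.log x ≤ (5 + 2 * Kr) * x * (δ * u) := by gcongr
        _ = (C₀ - 1 / 77) * Γ * x * u := by rw [hδ]; field_simp
    have e1 : C₀ * Γ * x / Real.log x =
        Γ / 77 * x / Real.log x + (C₀ - 1 / 77) * Γ * x / Real.log x := by ring
    linarith [hWx, hWle, hkey, e1]
  refine ⟨?_, ?_⟩
  · -- infinitely many `n`
    intro hfin
    set Tf := hfin.toFinset with hTf
    have hcount : ∀ x : ℝ, (((Finset.Icc 1 ⌊x⌋₊).filter fun n : ℕ =>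
        Nat.IsAtMostAlmostPrime 2 (gAbs a b c n)).card : ℝ) ≤ Tf.card := by
      intro x
      have : ((Finset.Icc 1 ⌊x⌋₊).filter fun n : ℕ =>
          Nat.IsAtMostAlmostPrime 2 (gAbs a b c n)) ⊆ Tf := by
        intro n hn
        rw [hTf, Set.Finite.mem_toFinset]
        exact (Finset.mem_filter.mp hn).2
      exact_mod_cast Finset.card_le_card this
    -- `Γ/77 · x / log x → ∞`
    set δ' : ℝ := Γ / 77 / (Tf.card + 1) with hδ'
    have hδ'0 : 0 < δ' := by positivity
    have hlog' : ∀ᶠ x : ℝ in atTop, ‖Real.log x‖ ≤ δ' * ‖x‖ :=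
      (Asymptotics.isLittleO_iff.mp Real.isLittleO_log_id_atTop) hδ'0
    obtain ⟨x, hqx, hlx, hx2⟩ := (hquant.and (hlog'.and (eventually_ge_atTop (2 : ℝ)))).exists
    have hx0 : 0 < x := by linarith
    have hL0 : 0 < Real.log x := Real.log_pos (by linarith)
    rw [Real.norm_eq_abs, Real.norm_eq_abs, abs_of_nonneg hL0.le, abs_of_nonneg hx0.le] at hlx
    have hbig : (Tf.card : ℝ) + 1 ≤ Γ / 77 * x / Real.log x := by
      rw [le_div_iff₀ hL0]
      calc ((Tf.card : ℝ) + 1) * Real.log x ≤ ((Tf.card : ℝ) + 1) * (δ' * x) := by gcongr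
        _ = Γ / 77 * x := by rw [hδ']; field_simp
    linarith [hcount x, hbig, hqx]
  · exact hquant

/-! ### Specialisation to `n² + 1`: the Theorem implies display (1) for `n² + 1` and parity.S19 -/

/-- `quadPoly 1 0 1 = X² + 1`, Iwaniec's principal case. [folklore] -/
theorem quadPoly_one_zero_one : quadPoly 1 0 1 = X ^ 2 + 1 := by
  simp [quadPoly]

/-- `X² + 1 = quadPoly 1 0 1` is irreducible in `ℤ[X]` (the tree's `irreducible_X_sq_add_one_int`).
[folklore] -/
theorem irreducible_quadPoly_one_zero_one : Irreducible (quadPoly 1 0 1) := by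
  rw [quadPoly_one_zero_one]; exact irreducible_X_sq_add_one_int

/-- `|1·n² + 0·n + 1| = n² + 1`. [folklore] -/
theorem natAbs_quad_one_zero_one (n : ℕ) :
    (1 * (n : ℤ) ^ 2 + 0 * n + 1).natAbs = n ^ 2 + 1 := by
  have e : (1 * (n : ℤ) ^ 2 + 0 * n + 1) = ((n ^ 2 + 1 : ℕ) : ℤ) := by push_cast; ring
  rw [e, Int.natAbs_natCast]

open scoped Classical in
/-- **The general Theorem implies its display (1) for `G = n² + 1`** (`card_P2_lower`):
`Γ_{X²+1} = gamma` (`hardyLittlewoodEConst / 2`).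
[cite: IwaniecInventiones1978, Theorem p. 172 (1)] -/
theorem card_P2_lower_of_theorem_quadratic (h : theorem_quadratic) : card_P2_lower := by
  have h1 := (h 1 0 1 one_pos odd_one irreducible_quadPoly_one_zero_one).2
  unfold card_P2_lower gamma hardyLittlewoodEConst
  refine h1.mono fun x hx => ?_
  have e1 : (![(C 1 * X ^ 2 + C 0 * X + C 1 : ℤ[X])]) = ![(X ^ 2 + 1 : ℤ[X])] := by
    rw [← quadPoly_one_zero_one]
  have e2 : ((Finset.Icc 1 ⌊x⌋₊).filter fun n : ℕ =>
      Nat.IsAtMostAlmostPrime 2 (1 * (n : ℤ) ^ 2 + 0 * n + 1).natAbs) =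
      ((Finset.Icc 1 ⌊x⌋₊).filter fun n : ℕ => Nat.IsAtMostAlmostPrime 2 (n ^ 2 + 1)) := by
    refine Finset.filter_congr fun n _ => ?_
    rw [natAbs_quad_one_zero_one]
  rw [e1, e2] at hx
  exact hx

/-- **The general Theorem implies parity.S19** (`Ω(n² + 1) ≤ 2` infinitely often).
[cite: IwaniecInventiones1978, Theorem p. 172] -/
theorem setOf_isAtMostAlmostPrime_two_sq_add_one_infinite_of_theorem_quadratic
    (h : theorem_quadratic) : setOf_isAtMostAlmostPrime_two_sq_add_one_infinite := by
  have h1 := (h 1 0 1 one_pos odd_one irreducible_quadPoly_one_zero_one).1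
  unfold setOf_isAtMostAlmostPrime_two_sq_add_one_infinite
  have e : {n : ℕ | Nat.IsAtMostAlmostPrime 2 (1 * (n : ℤ) ^ 2 + 0 * n + 1).natAbs} =
      {n : ℕ | Nat.IsAtMostAlmostPrime 2 (n ^ 2 + 1)} := by
    ext n
    simp only [Set.mem_setOf_eq]
    rw [natAbs_quad_one_zero_one]
  rw [e] at h1
  exact h1

/-! ### Sieve data of `𝒜 = {G(n) : 1 ≤ n ≤ x}` and identity (3) for general `G` — PROVED -/

open scoped Classical in
/-- The sifting function `S(𝒜_q, u) = #{a ∈ 𝒜_q : (a, P(u)) = 1}` of `𝒜 = {G(n) : 1 ≤ n ≤ x}`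
(Lemke Oliver (2.4); Iwaniec p. 174), `P(u) = primesProdBelow u`, members read through `|G(n)|`.
[cite: LemkeOliverActaArith2012, §2.1 (2.4)] -/
def siftedCountG (a b c : ℤ) (x : ℝ) (q : ℕ) (u : ℝ) : ℕ :=
  ((Finset.Icc 1 ⌊x⌋₊).filter fun n : ℕ =>
    q ∣ gAbs a b c n ∧ Nat.Coprime (gAbs a b c n) (primesProdBelow u)).card

section Identity3G

variable {x z : ℝ}

open scoped Classical in
/-- The index set of `{a ∈ 𝒜 : (a, P(z)) = 1}` for `𝒜 = {G(n) : 1 ≤ n ≤ x}`.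
[cite: LemkeOliverActaArith2012, §2.1 (2.3)] -/
def siftedSetG (a b c : ℤ) (x z : ℝ) : Finset ℕ :=
  (Finset.Icc 1 ⌊x⌋₊).filter (fun n : ℕ => Nat.Coprime (gAbs a b c n) (primesProdBelow z))

/-- `S(𝒜, z) = S(𝒜_1, z) = #siftedSetG`. [folklore] -/
theorem siftedCountG_one (a b c : ℤ) (x z : ℝ) :
    siftedCountG a b c x 1 z = (siftedSetG a b c x z).card := by
  unfold siftedCountG siftedSetG
  congr 1
  exact Finset.filter_congr fun n _ => by simp

/-- Membership in `siftedSetG`. [folklore] -/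
theorem mem_siftedSetG {n : ℕ} : n ∈ siftedSetG a b c x z ↔
    n ∈ Finset.Icc 1 ⌊x⌋₊ ∧ Nat.Coprime (gAbs a b c n) (primesProdBelow z) := by
  unfold siftedSetG; exact Finset.mem_filter

/-- A natural number with a prime divisor is not `1`. [folklore] -/
theorem ne_one_of_prime_dvd {p m : ℕ} (hp : p.Prime) (h : p ∣ m) : m ≠ 1 := by
  rintro rfl
  exact hp.ne_one (Nat.dvd_one.mp h)

open scoped Classical in
/-- **Lemke Oliver p. 244 / Iwaniec p. 174, first display, general `G` — PROVED:**
`W(𝒜, z) = S(𝒜, z) − ∑_{z ≤ p < X} ∑_{a ∈ 𝒜_p, (a, P(z)) = 1} ω_p(a)` (weights at `λ = 2`, size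
parameter `X = Kx`), provided no `G(n)` vanishes (true for irreducible `G`,
`quadPoly_eval_ne_zero`). [cite: LemkeOliverActaArith2012, §2.1 (2.5)] -/
theorem weightedSumG_eq_card_sub (hG : ∀ n : ℕ, gAbs a b c n ≠ 0) (x z : ℝ) :
    weightedSumG a b c x z = (siftedCountG a b c x 1 z : ℝ) -
      ∑ p ∈ primesIn z ((sizeK a b c : ℝ) * x),
        ∑ n ∈ (siftedSetG a b c x z).filter (fun n : ℕ => p ∣ gAbs a b c n),
          omegaWeight ((sizeK a b c : ℝ) * x) (gAbs a b c n) p := by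
  rw [siftedCountG_one]
  unfold weightedSumG richertWeight
  rw [show (Finset.Icc 1 ⌊x⌋₊).filter
      (fun n : ℕ => Nat.Coprime (gAbs a b c n) (primesProdBelow z)) = siftedSetG a b c x z from rfl]
  rw [Finset.sum_sub_distrib, Finset.sum_const, nsmul_eq_mul, mul_one]
  congr 1
  simp only [show (3 : ℝ) - 2 = 1 by norm_num, inv_one, one_mul]
  refine Finset.sum_comm' fun n p => ?_
  simp only [Finset.mem_filter, mem_primesIn, siftedSetG]
  constructor
  · rintro ⟨⟨hn, hcop⟩, hp, hpx⟩
    have hpp := Nat.prime_of_mem_primeFactors hp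
    have hpd := Nat.dvd_of_mem_primeFactors hp
    exact ⟨⟨⟨hn, hcop⟩, hpd⟩, hpp, (coprime_primesProdBelow_iff_forall _ _).mp hcop p hpp hpd, hpx⟩
  · rintro ⟨⟨⟨hn, hcop⟩, hpd⟩, hpp, _, hpx⟩
    exact ⟨⟨hn, hcop⟩, Nat.mem_primeFactors.mpr ⟨hpp, hpd, hG n⟩, hpx⟩

open scoped Classical in
/-- `{a ∈ 𝒜_p : (a, P(z)) = 1}` is the set counted by `S(𝒜_p, z)`. [folklore] -/
theorem filter_dvd_siftedSetG (p : ℕ) :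
    (siftedSetG a b c x z).filter (fun n : ℕ => p ∣ gAbs a b c n) =
      (Finset.Icc 1 ⌊x⌋₊).filter fun n : ℕ =>
        p ∣ gAbs a b c n ∧ Nat.Coprime (gAbs a b c n) (primesProdBelow z) := by
  unfold siftedSetG
  rw [Finset.filter_filter]
  exact Finset.filter_congr fun n _ => and_comm

open scoped Classical in
/-- The elements of `𝒜_p` sifted by `P(z)` whose least prime factor is `p` (`p ≥ z` prime) are
exactly those of `𝒜_p` sifted by `P(p)`. [cite: IwaniecInventiones1978, §2 p. 174] -/
theorem filter_minFac_eq_selfG {p : ℕ} (hp : p.Prime) (hzp : z ≤ (p : ℝ)) :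
    (siftedSetG a b c x z).filter (fun n : ℕ => p ∣ gAbs a b c n ∧ (gAbs a b c n).minFac = p) =
      (Finset.Icc 1 ⌊x⌋₊).filter fun n : ℕ =>
        p ∣ gAbs a b c n ∧ Nat.Coprime (gAbs a b c n) (primesProdBelow p) := by
  unfold siftedSetG
  rw [Finset.filter_filter]
  refine Finset.filter_congr fun n _ => ?_
  constructor
  · rintro ⟨_, hpd, hmin⟩
    have h1 : gAbs a b c n ≠ 1 := ne_one_of_prime_dvd hp hpd
    exact ⟨hpd, (coprime_primesProdBelow_iff_le_minFac h1 _).mpr (by rw [hmin])⟩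
  · rintro ⟨hpd, hle⟩
    have h1 : gAbs a b c n ≠ 1 := ne_one_of_prime_dvd hp hpd
    rw [coprime_primesProdBelow_iff_le_minFac h1] at hle ⊢
    have hle' : p ≤ (gAbs a b c n).minFac := by exact_mod_cast hle
    have hge : (gAbs a b c n).minFac ≤ p := Nat.minFac_le_of_dvd hp.two_le hpd
    have heq : (gAbs a b c n).minFac = p := le_antisymm hge hle'
    exact ⟨by rw [heq]; exact hzp, hpd, heq⟩

open scoped Classical in
/-- The elements of `𝒜_p` sifted by `P(z)` whose least prime factor is `p₁`, `z ≤ p₁ < p`, are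
exactly those of `𝒜_{pp₁}` sifted by `P(p₁)`. [cite: IwaniecInventiones1978, §2 p. 174] -/
theorem filter_minFac_eq_of_ltG {p p₁ : ℕ} (hp : p.Prime) (hp₁ : p₁.Prime) (hlt : p₁ < p)
    (hzp : z ≤ (p₁ : ℝ)) :
    (siftedSetG a b c x z).filter (fun n : ℕ => p ∣ gAbs a b c n ∧ (gAbs a b c n).minFac = p₁) =
      (Finset.Icc 1 ⌊x⌋₊).filter fun n : ℕ =>
        p * p₁ ∣ gAbs a b c n ∧ Nat.Coprime (gAbs a b c n) (primesProdBelow p₁) := by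
  unfold siftedSetG
  rw [Finset.filter_filter]
  refine Finset.filter_congr fun n _ => ?_
  have hcop : Nat.Coprime p p₁ := (Nat.coprime_primes hp hp₁).mpr hlt.ne'
  constructor
  · rintro ⟨_, hpd, hmin⟩
    have h1 : gAbs a b c n ≠ 1 := ne_one_of_prime_dvd hp hpd
    refine ⟨hcop.mul_dvd_of_dvd_of_dvd hpd (hmin ▸ Nat.minFac_dvd _), ?_⟩
    exact (coprime_primesProdBelow_iff_le_minFac h1 _).mpr (by rw [hmin])
  · rintro ⟨hpd, hle⟩
    have hpd' : p ∣ gAbs a b c n := dvd_trans (dvd_mul_right p p₁) hpd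
    have hp₁d : p₁ ∣ gAbs a b c n := dvd_trans (dvd_mul_left p₁ p) hpd
    have h1 : gAbs a b c n ≠ 1 := ne_one_of_prime_dvd hp hpd'
    rw [coprime_primesProdBelow_iff_le_minFac h1] at hle ⊢
    have hle' : p₁ ≤ (gAbs a b c n).minFac := by exact_mod_cast hle
    have hge : (gAbs a b c n).minFac ≤ p₁ := Nat.minFac_le_of_dvd hp₁.two_le hp₁d
    have heq : (gAbs a b c n).minFac = p₁ := le_antisymm hge hle'
    exact ⟨by rw [heq]; exact hzp, hpd', heq⟩

open scoped Classical in
/-- **Buchstab's identity for `𝒜_G` — PROVED:** for a prime `p ≥ z`,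
`S(𝒜_p, z) = S(𝒜_p, p) + ∑_{z ≤ p₁ < p} S(𝒜_{pp₁}, p₁)`.
[cite: IwaniecInventiones1978, §2 p. 174] -/
theorem siftedCountG_buchstab {p : ℕ} (hp : p.Prime) (hzp : z ≤ (p : ℝ)) :
    (siftedCountG a b c x p z : ℝ) = siftedCountG a b c x p p +
      ∑ p₁ ∈ primesIn z p, (siftedCountG a b c x (p * p₁) p₁ : ℝ) := by
  have hsplit := (Finset.card_filter_add_card_filter_not
    (s := (siftedSetG a b c x z).filter (fun n : ℕ => p ∣ gAbs a b c n))
    (fun n : ℕ => (gAbs a b c n).minFac = p))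
  rw [Finset.filter_filter, Finset.filter_filter, filter_minFac_eq_selfG hp hzp,
    filter_dvd_siftedSetG] at hsplit
  unfold siftedCountG
  rw [← hsplit, Nat.cast_add]
  congr 1
  rw [Finset.card_eq_sum_card_fiberwise (f := fun n : ℕ => (gAbs a b c n).minFac)
    (t := primesIn z p) ?_]
  · push_cast
    refine Finset.sum_congr rfl fun p₁ hp₁ => ?_
    rw [mem_primesIn] at hp₁
    have hlt : p₁ < p := by exact_mod_cast hp₁.2.2
    rw [Finset.filter_filter, ← filter_minFac_eq_of_ltG hp hp₁.1 hlt hp₁.2.1]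
    congr 2
    refine Finset.filter_congr fun n _ => ⟨fun h => ⟨h.1.1, h.2⟩, fun h => ⟨⟨h.1, ?_⟩, h.2⟩⟩
    rw [h.2]; exact hlt.ne
  · intro n hn
    rw [Finset.mem_coe, Finset.mem_filter, mem_siftedSetG] at hn
    obtain ⟨⟨_, hcop⟩, hpd, hne⟩ := hn
    have h1 : gAbs a b c n ≠ 1 := ne_one_of_prime_dvd hp hpd
    rw [Finset.mem_coe, mem_primesIn]
    refine ⟨Nat.minFac_prime h1, (coprime_primesProdBelow_iff_le_minFac h1 z).mp hcop, ?_⟩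
    exact_mod_cast lt_of_le_of_ne (Nat.minFac_le_of_dvd hp.two_le hpd) hne

open scoped Classical in
/-- For `p ≥ X^{1/2}`: `∑_{a ∈ 𝒜_p, (a,P(z))=1} ω_p(a) = (1 − log p/log X) S(𝒜_p, z)`.
[cite: IwaniecInventiones1978, §2 p. 174] -/
theorem sum_omegaWeight_of_sqrt_leG {X : ℝ} {p : ℕ} (hpx : ¬ (p : ℝ) < X ^ (1 / 2 : ℝ)) :
    ∑ n ∈ (siftedSetG a b c x z).filter (fun n : ℕ => p ∣ gAbs a b c n),
        omegaWeight X (gAbs a b c n) p =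
      (1 - Real.log p / Real.log X) * siftedCountG a b c x p z := by
  rw [Finset.sum_congr rfl fun n _ => show omegaWeight X (gAbs a b c n) p =
      1 - Real.log p / Real.log X by
        unfold omegaWeight; split_ifs <;> rfl,
    Finset.sum_const, nsmul_eq_mul, mul_comm, filter_dvd_siftedSetG]
  rfl

open scoped Classical in
/-- For `z ≤ p < X^{1/2}`: `∑_{a ∈ 𝒜_p, (a,P(z))=1} ω_p(a)
= (1 − log p/log X) S(𝒜_p, p) + ∑_{z ≤ p₁ < p} (log p₁/log X) S(𝒜_{pp₁}, p₁)`.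
[cite: IwaniecInventiones1978, §2 p. 174] -/
theorem sum_omegaWeight_of_lt_sqrtG {X : ℝ} {p : ℕ} (hp : p.Prime) (hzp : z ≤ (p : ℝ))
    (hpx : (p : ℝ) < X ^ (1 / 2 : ℝ)) :
    ∑ n ∈ (siftedSetG a b c x z).filter (fun n : ℕ => p ∣ gAbs a b c n),
        omegaWeight X (gAbs a b c n) p =
      (1 - Real.log p / Real.log X) * siftedCountG a b c x p p +
        ∑ p₁ ∈ primesIn z p, Real.log p₁ / Real.log X * siftedCountG a b c x (p * p₁) p₁ := by
  rw [← Finset.sum_filter_add_sum_filter_not _ (fun n : ℕ => (gAbs a b c n).minFac = p)]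
  congr 1
  · rw [Finset.sum_congr rfl fun n hn => show omegaWeight X (gAbs a b c n) p =
        1 - Real.log p / Real.log X by
          rw [Finset.mem_filter] at hn
          unfold omegaWeight; rw [if_pos hn.2.symm],
      Finset.sum_const, nsmul_eq_mul, mul_comm, Finset.filter_filter,
      filter_minFac_eq_selfG hp hzp]
    rfl
  · rw [Finset.sum_congr rfl fun n hn => show omegaWeight X (gAbs a b c n) p =
        Real.log (gAbs a b c n).minFac / Real.log X by
          rw [Finset.mem_filter] at hn
          unfold omegaWeight; rw [if_neg (Ne.symm hn.2), if_pos hpx]]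
    rw [← Finset.sum_fiberwise_of_maps_to (g := fun n : ℕ => (gAbs a b c n).minFac)
      (t := primesIn z p) ?_]
    · refine Finset.sum_congr rfl fun p₁ hp₁ => ?_
      rw [mem_primesIn] at hp₁
      have hlt : p₁ < p := by exact_mod_cast hp₁.2.2
      rw [Finset.sum_congr rfl fun n hn =>
          show Real.log ((gAbs a b c n).minFac : ℕ) / Real.log X = Real.log p₁ / Real.log X by
            rw [(Finset.mem_filter.mp hn).2],
        Finset.sum_const, nsmul_eq_mul, mul_comm]
      congr 1
      unfold siftedCountG
      rw [← filter_minFac_eq_of_ltG hp hp₁.1 hlt hp₁.2.1, Finset.filter_filter,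
        Finset.filter_filter]
      congr 2
      refine Finset.filter_congr fun n _ => ⟨fun h => ⟨h.1, h.2.2⟩, fun h => ⟨h.1, ?_, h.2⟩⟩
      rw [h.2]; exact hlt.ne
    · intro n hn
      rw [Finset.mem_filter, Finset.mem_filter, mem_siftedSetG] at hn
      obtain ⟨⟨⟨_, hcop⟩, hpd⟩, hne⟩ := hn
      have h1 : gAbs a b c n ≠ 1 := ne_one_of_prime_dvd hp hpd
      rw [mem_primesIn]
      refine ⟨Nat.minFac_prime h1, (coprime_primesProdBelow_iff_le_minFac h1 z).mp hcop, ?_⟩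
      exact_mod_cast lt_of_le_of_ne (Nat.minFac_le_of_dvd hp.two_le hpd) hne

open scoped Classical in
/-- **Identity (3) of Iwaniec / (2.5) of Lemke Oliver for general `G` — PROVED** (weights at
`λ = 2` with size parameter `X = Kx`; the double sum carries `log(p/p₁)`, the corrected sign).
For `X ≥ 1`, `z ≤ X^{1/2}` and `G` without integer roots:
`W(𝒜, z) = S(𝒜, z) + ∑∑_{z ≤ p₁ < p < X^{1/2}} (log(p/p₁)/log X) S(𝒜_{pp₁}, p₁)
  − ∑_{z ≤ p < X^{1/2}} {(1 − 2 log p/log X) S(𝒜_p, p) + (log p/log X) S(𝒜_p, z)}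
  − ∑_{X^{1/2} ≤ p < X} (1 − log p/log X) S(𝒜_p, z)`.
[cite: LemkeOliverActaArith2012, §2.1 (2.5)] -/
theorem weightedSumG_eq (hG : ∀ n : ℕ, gAbs a b c n ≠ 0)
    (hX : 1 ≤ (sizeK a b c : ℝ) * x) (hz : z ≤ ((sizeK a b c : ℝ) * x) ^ (1 / 2 : ℝ)) :
    weightedSumG a b c x z =
      (siftedCountG a b c x 1 z : ℝ)
      + ∑ p ∈ primesIn z (((sizeK a b c : ℝ) * x) ^ (1 / 2 : ℝ)), ∑ p₁ ∈ primesIn z p,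
          Real.log ((p : ℝ) / p₁) / Real.log ((sizeK a b c : ℝ) * x) *
            (siftedCountG a b c x (p * p₁) p₁ : ℝ)
      - ∑ p ∈ primesIn z (((sizeK a b c : ℝ) * x) ^ (1 / 2 : ℝ)),
          ((1 - 2 * Real.log p / Real.log ((sizeK a b c : ℝ) * x)) *
              (siftedCountG a b c x p p : ℝ)
            + Real.log p / Real.log ((sizeK a b c : ℝ) * x) * (siftedCountG a b c x p z : ℝ))
      - ∑ p ∈ primesIn (((sizeK a b c : ℝ) * x) ^ (1 / 2 : ℝ)) ((sizeK a b c : ℝ) * x),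
          (1 - Real.log p / Real.log ((sizeK a b c : ℝ) * x)) *
            (siftedCountG a b c x p z : ℝ) := by
  set X : ℝ := (sizeK a b c : ℝ) * x with hXdef
  rw [weightedSumG_eq_card_sub hG x z,
    ← Finset.sum_filter_add_sum_filter_not (primesIn z X) (fun p : ℕ => (p : ℝ) < X ^ (1 / 2 : ℝ)),
    primesIn_filter_lt hX, primesIn_filter_not_lt hz]
  rw [Finset.sum_congr rfl fun p hp => sum_omegaWeight_of_sqrt_leG (a := a) (b := b) (c := c)
    (x := x) (z := z) (not_lt.mpr (mem_primesIn.mp hp).2.1)]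
  rw [Finset.sum_congr rfl fun p hp => sum_omegaWeight_of_lt_sqrtG (a := a) (b := b) (c := c)
    (x := x) (z := z) (mem_primesIn.mp hp).1 (mem_primesIn.mp hp).2.1 (mem_primesIn.mp hp).2.2]
  have key : ∀ p ∈ primesIn z (X ^ (1 / 2 : ℝ)),
      (1 - Real.log p / Real.log X) * (siftedCountG a b c x p p : ℝ) +
          ∑ p₁ ∈ primesIn z p, Real.log p₁ / Real.log X * (siftedCountG a b c x (p * p₁) p₁ : ℝ) =
        ((1 - 2 * Real.log p / Real.log X) * (siftedCountG a b c x p p : ℝ)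
            + Real.log p / Real.log X * (siftedCountG a b c x p z : ℝ)) -
          ∑ p₁ ∈ primesIn z p,
            Real.log ((p : ℝ) / p₁) / Real.log X * (siftedCountG a b c x (p * p₁) p₁ : ℝ) := by
    intro p hp
    rw [mem_primesIn] at hp
    have hp0 : (p : ℝ) ≠ 0 := by exact_mod_cast hp.1.ne_zero
    rw [siftedCountG_buchstab hp.1 hp.2.1, mul_add, Finset.mul_sum]
    have e1 : ∑ p₁ ∈ primesIn z p, Real.log p / Real.log X *
          (siftedCountG a b c x (p * p₁) p₁ : ℝ) -
        ∑ p₁ ∈ primesIn z p,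
          Real.log ((p : ℝ) / p₁) / Real.log X * (siftedCountG a b c x (p * p₁) p₁ : ℝ) -
        ∑ p₁ ∈ primesIn z p, Real.log p₁ / Real.log X *
          (siftedCountG a b c x (p * p₁) p₁ : ℝ) = 0 := by
      rw [← Finset.sum_sub_distrib, ← Finset.sum_sub_distrib]
      refine Finset.sum_eq_zero fun p₁ hp₁ => ?_
      rw [Real.log_div hp0 (by exact_mod_cast (mem_primesIn.mp hp₁).1.ne_zero)]
      ring
    linear_combination (-1 : ℝ) * e1
  rw [Finset.sum_congr rfl key, Finset.sum_sub_distrib]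
  ring

end Identity3G

/-! ### The qualitative Theorem from a constant-free lower bound for `W(𝒜, z)` — PROVED -/

open scoped Classical in
/-- **`G(n) = P₂` infinitely often from `W(𝒜_G, x^{1/5}) ≫ x/log x` — PROVED** (the form in which
Lemke Oliver concludes his Theorem 1, p. 244: "with the goal of showing that `W(𝒜, z) ≫ x/log x`";
no value of the constant is needed).  If `W(𝒜_G, x^{1/5}) ≥ C x/log x` for all large `x` with some
`C > 0`, then `Ω(|G(n)|) ≤ 2` for infinitely many `n`: otherwise `weightedSumG_le_card` bounds
`W ≤ K₀ + (4 + 2K) x^{9/10}` with `K₀` constant, contradicting `log x = o(x^{1/10})`.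
[cite: LemkeOliverActaArith2012, §2.1 p. 244] -/
theorem infinite_setOf_isAtMostAlmostPrime_of_weightedSumG_pos (ha : 0 < a)
    (hirr : Irreducible (quadPoly a b c))
    (h : ∃ C : ℝ, 0 < C ∧ ∀ᶠ x : ℝ in atTop,
      C * x / Real.log x ≤ weightedSumG a b c x (x ^ (1 / 5 : ℝ))) :
    {n : ℕ | Nat.IsAtMostAlmostPrime 2 (a * (n : ℤ) ^ 2 + b * n + c).natAbs}.Infinite := by
  obtain ⟨C₀, hC₀, hW⟩ := h
  intro hfin
  set Tf := hfin.toFinset with hTf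
  set Kr : ℝ := (sizeK a b c : ℝ) with hKr
  have hK1 : 1 ≤ Kr := one_le_sizeK ha
  have hcount : ∀ x : ℝ, (((Finset.Icc 1 ⌊x⌋₊).filter fun n : ℕ =>
      Nat.IsAtMostAlmostPrime 2 (gAbs a b c n)).card : ℝ) ≤ Tf.card := by
    intro x
    have : ((Finset.Icc 1 ⌊x⌋₊).filter fun n : ℕ =>
        Nat.IsAtMostAlmostPrime 2 (gAbs a b c n)) ⊆ Tf := by
      intro n hn
      rw [hTf, Set.Finite.mem_toFinset]
      exact (Finset.mem_filter.mp hn).2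
    exact_mod_cast Finset.card_le_card this
  -- `log x ≤ δ x^{1/10}` eventually, with `δ (Tf.card + 5 + 2K) = C₀`
  set δ : ℝ := C₀ / ((Tf.card : ℝ) + 5 + 2 * Kr) with hδ
  have hδ0 : 0 < δ := by positivity
  have hlog : ∀ᶠ x : ℝ in atTop, ‖Real.log x‖ ≤ δ * ‖x ^ (1 / 10 : ℝ)‖ :=
    (Asymptotics.isLittleO_iff.mp
      (isLittleO_log_rpow_atTop (by norm_num : (0 : ℝ) < 1 / 10))) hδ0
  set x₀ : ℝ := ((a + |b ^ 2 - 4 * a * c| + 2 : ℤ) : ℝ) ^ (5 : ℕ) with hx₀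
  obtain ⟨x, hWx, hlogx, hxx₀, hx32⟩ :=
    (hW.and (hlog.and ((eventually_ge_atTop x₀).and (eventually_ge_atTop (32 : ℝ))))).exists
  have hx1 : 1 < x := by linarith
  have hx0 : 0 < x := by linarith
  set u : ℝ := x ^ (1 / 10 : ℝ) with hu
  have hu1 : 1 ≤ u := Real.one_le_rpow hx1.le (by norm_num)
  have hu0 : 0 < u := by linarith
  have hxu : u ^ 10 = x := by
    rw [hu, ← Real.rpow_mul_natCast hx0.le]; norm_num
  have hz2 : x ^ (1 / 5 : ℝ) = u ^ 2 := by
    rw [hu, ← Real.rpow_mul_natCast hx0.le]; norm_num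
  have hsqrt : Real.sqrt (x ^ (1 / 5 : ℝ)) = u := by
    rw [hz2, Real.sqrt_sq hu0.le]
  set T : ℝ := ((a + |b ^ 2 - 4 * a * c| + 2 : ℤ) : ℝ) with hT
  have hT2 : 2 ≤ T := by
    have : (2 : ℤ) ≤ a + |b ^ 2 - 4 * a * c| + 2 := by
      have := abs_nonneg (b ^ 2 - 4 * a * c); omega
    rw [hT]; exact_mod_cast this
  have hTz : T ≤ x ^ (1 / 5 : ℝ) := by
    have h5 : T ^ (5 : ℕ) ≤ x := hxx₀
    have hT0 : 0 ≤ T := by linarith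
    calc T = (T ^ (5 : ℕ)) ^ (1 / 5 : ℝ) := by
          rw [← Real.rpow_natCast, ← Real.rpow_mul hT0]; norm_num
      _ ≤ x ^ (1 / 5 : ℝ) := Real.rpow_le_rpow (by positivity) h5 (by norm_num)
  have h2z : (2 : ℝ) ≤ x ^ (1 / 5 : ℝ) := hT2.trans hTz
  have hza : (a : ℝ) < x ^ (1 / 5 : ℝ) := by
    have : (a : ℝ) < T := by
      rw [hT]; push_cast
      have := abs_nonneg ((b : ℝ) ^ 2 - 4 * a * c)
      linarith
    exact this.trans_le hTz
  have hzd : ((|b ^ 2 - 4 * a * c| : ℤ) : ℝ) < x ^ (1 / 5 : ℝ) := by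
    have : ((|b ^ 2 - 4 * a * c| : ℤ) : ℝ) < T := by
      rw [hT]; push_cast
      have : (0 : ℝ) < a := by exact_mod_cast ha
      linarith
    exact this.trans_le hTz
  have hWle := weightedSumG_le_card ha hirr hx1 h2z hza hzd
  rw [hsqrt] at hWle
  have hL0 : 0 < Real.log x := Real.log_pos hx1
  have hLu : Real.log x ≤ δ * u := by
    rw [Real.norm_eq_abs, Real.norm_eq_abs, abs_of_nonneg hL0.le,
      abs_of_nonneg (Real.rpow_nonneg hx0.le _)] at hlogx
    exact hlogx
  -- `Tf.card + (4 + 2K) x/u < (Tf.card + 5 + 2K) x/u ≤ C₀ x / log x ≤ W ≤ Tf.card + (4 + 2K) x/u`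
  have hxu1 : x / u ≥ 1 := by
    rw [ge_iff_le, le_div_iff₀ hu0, one_mul]
    calc u ≤ u ^ 10 := le_self_pow₀ hu1 (by norm_num)
      _ = x := hxu
  have hkey : (Tf.card : ℝ) + (4 + 2 * Kr) * x / u < C₀ * x / Real.log x := by
    have h1 : (Tf.card : ℝ) + (4 + 2 * Kr) * x / u < ((Tf.card : ℝ) + 5 + 2 * Kr) * x / u := by
      have e : ((Tf.card : ℝ) + 5 + 2 * Kr) * x / u =
          (Tf.card : ℝ) * (x / u) + (x / u) + (4 + 2 * Kr) * x / u := by ring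
      rw [e]
      have hT0 : (0 : ℝ) ≤ Tf.card := Nat.cast_nonneg _
      nlinarith
    refine h1.trans_le ?_
    rw [div_le_div_iff₀ hu0 hL0]
    calc ((Tf.card : ℝ) + 5 + 2 * Kr) * x * Real.log x
        ≤ ((Tf.card : ℝ) + 5 + 2 * Kr) * x * (δ * u) := by gcongr
      _ = C₀ * x * u := by rw [hδ]; field_simp
  linarith [hWx, hWle, hkey, hcount x]

end Literature.NumberTheory.Sieve.Iwaniec1978

end
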